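import Summits.BirchSwinnertonDyer.BirchSwinnertonDyer.Theorems.ManinLocalTwoThreeThreeTorsionGeomPoint
import Summits.BirchSwinnertonDyer.Rank1Residual.ManinAdditive.ThreeIsogenyKernelLaws
import Literature.NumberTheory.EllipticCurves.IsogenyQuotientCurveProofs
import Literature.NumberTheory.EllipticCurves.IsogenyVariableChangeProofs
import Literature.NumberTheory.EllipticCurves.IsogenyCompProofs
import Literature.NumberTheory.EllipticCurves.IsogenyMultiplierDegreeProofs
import Literature.NumberTheory.EllipticCurves.IsogenyRealPeriodProofs
import Literature.NumberTheory.EllipticCurves.IsogenyComplexUniformizationProofs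
import Literature.NumberTheory.EllipticCurves.GlobalMinimalModelProofs
import Summits.BirchSwinnertonDyer.BirchSwinnertonDyer.Theorems.ManinLocalTwoThreeCoprimeIsolatedResidualSplit
import Summits.BirchSwinnertonDyer.Rank1Residual.ManinAdditive.CuspidalKummerCubeLaws
import Literature.NumberTheory.EllipticCurves.KatoAdditiveTwistedValueNeronIntegralityThree
import HarnessLib

/-!
# (VÉLU₃♯) BY NAME: a congruent rational `3`-torsion point spans an ASCENDING constant-kernel `3`-edge, as an `Isogeny`
# object — `VeluAscendingEdgeOfCongruenceAtNine` PROVED; hence NB₃ and NB₃^V follow from an's E-an-100₉ / E-an-100 / E-an-99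

Summit `BirchSwinnertonDyer`, route `ManinLocalTwoThree` (cell bsd-f2-manin), crux C3 `ManinPrimeToThreeAtNine`
(stmt-BirchSwinnertonDyer-22968), line `kato_shift_three` (v14: stub NB₃^V `NoAscendingThreeTorsionOptimal`).  The typer's row
(VÉLU₃♯) `ThreeIsogenyKernel.VeluAscendingEdgeOfCongruenceAtNine` (p645148; an's `Isogeny`-language: «a rational point `T` of
order `3` on `E♮` with `Y₁ ≡ 4(α/3)³ (mod 9)` spans, at a datum of level `9 ∣ N`, an isogeny `φ : W → W₂` onto a globally minimal
`W₂` with `deg φ = 3`, `covol Λ(W₂) = 3·covol Λ(W)` and CONSTANT kernel») was filed as an open obligation «needing `Isogeny`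
EXISTENCE for `W → W/⟨T⟩`, which the tree does not construct».  This file constructs it and proves the row:

* §1 (file `…ThreeTorsionGeomPoint.lean`) `exists_geomPoint_of_isShortThreeTorsion` — `T` as a `Γ_ℚ`-fixed point `P₀ ∈ W(ℚ̄)`
  of order `3`.
* §2 `veluAscendingEdgeOfCongruenceAtNine_holds` — **(VÉLU₃♯) PROVED.**  `⟨P₀⟩` is `Γ_ℚ`-stable of order `3`; the tree's
  quotient isogeny `W → W/⟨P₀⟩` (`exists_isogeny_ker_eq_and_comp_eq_nsmul_holds`, Silverman III.4.12) composed with the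
  substitution onto a global minimal model (Néron, `hasGlobalMinimalModel_rat_holds`, `VariableChange.toIsogeny`) is
  `φ : W → W₂`, `deg φ = #⟨P₀⟩ = 3`, constant kernel.  Analytically `φ_ℂ(u(z)) = u₂(αz)` on the datum's uniformisation
  (`Isogeny.exists_mul_baseChange_apply_eq`, Silverman VI.4.1(b)) with `α ∈ ℚ` (`exists_algebraMap_eq_of_baseChange_apply_eq`);
  the third-period `z_T` (`℘(z_T) = X₁`, p3's `exists_third_period_of_Ψ₃_root`) uniformises `±P₀`
  (`Affine.Y_eq_of_X_eq`), so `αz_T ∈ Λ₂`; with Vélu's lattice `Λ_V = Λ + ℤz_T` (`lattice_eq_of_velu_three_invariants`) the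
  sandwich `αΛ ⊊ αΛ_V ⊆ Λ₂`, `[Λ₂ : αΛ] = #ker φ_ℂ = deg φ = 3` (`natCard_ker_baseChange_eq_degree`) forces `Λ₂ = αΛ_V`, whence
  `α⁴c₄(W₂) = A`, `α⁶c₆(W₂) = B` (`IsNeronLatticeOf.c₄_eq_of_lattice_eq_mulLeft`), `α ∈ ℤ`, `α ∣ 3`
  (`exists_int_eq_and_dvd_of_neronScaling`); `α = ±1` is excluded by the lead's local theorem
  `not_exists_isGloballyMinimal_velu_three_of_congruence` (p645684), so `α² = 9` and
  `covol Λ₂ = covol(αΛ)/3 = 3·covol Λ` (`ZLattice.covolume_div_covolume_eq_relIndex'`, `PeriodPair.covolume_mulLeft_lattice`).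
* §3 BY-NAME EDGES: `noBlindThreeTorsionOptimal_of_noConstantKernelAscendingAtNine` (**NB₃ ⟸ E-an-100₉**),
  `noAscendingThreeTorsionOptimal_of_noConstantKernelAscendingAtNine` (**NB₃^V ⟸ E-an-100₉**, using ascent ⟹ congruence,
  p646773) and `noAscendingThreeTorsionOptimal_of_optimalAscendingThreeKernelIsMu` (**NB₃^V ⟸ E-an-99 ASCμ₃**, via an's proved
  edges E-an-99 ⟹ E-an-100 ⟹ E-an-100₉).  So the v14 stub may be fed BY NAME by any of an's Stevens-ledger rows.

* §4 THE C3 LINE BY NAME (v14 compositions as tree theorems): C3 `ManinPrimeToThreeAtNine` ⟸ F-es-18 ∧ E-an-57 ∧ LAW₃♮ ∧ X ∧ RES₃♭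
  for X ∈ {NB₃^V, E-an-100₉, E-an-99} (`maninPrimeToThreeAtNine_of_…_of_noAscending_…`, `…_of_noConstantKernelAscending_…`,
  `…_of_kernelIsMu_…`), over the lead's v10 composition `…_of_noBlindLaws_of_coprimeIsolated`.

HONEST FRAMING: a construction and implications between `c`-free laws; E-an-99/100/100₉ and NB₃^V stay OPEN (all are
implied on paper by Stevens' Conjecture II, refuter-1 §R66 Prop. 4); C3, Manin's conjecture and BSD are NOT proved.
No definitions, no named facts, no sorry.

References: [SilvermanAEC2009] III.2.3, Ex. 3.7, III.4.12, VI.4.1(b), VIII.8; Vélu 1971; [DokchitserDokchitser2015LocalInvariants] §4.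
-/

set_option linter.dupNamespace false
set_option autoImplicit false

noncomputable section

open scoped Classical

open WeierstrassCurve IsDedekindDomain NumberField Rat.HeightOneSpectrum Polynomial
  Literature.NumberTheory.DiophantineGeometry Literature.NumberTheory.EllipticCurves
  Literature.NumberTheory.EllipticCurves.ModularForms
  Summit.BirchSwinnertonDyer.Rank1Residual.ManinAdditive
  Summit.BirchSwinnertonDyer.Rank1Residual.ManinAdditive.CuspidalKummer
  Summit.BirchSwinnertonDyer.Rank1Residual.ManinAdditive.CuspidalKummerThree
  Summit.BirchSwinnertonDyer.Rank1Residual.ManinAdditive.ThreeIsogenyKernel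

namespace Summit.BirchSwinnertonDyer.BirchSwinnertonDyer.Theorems.ManinLocalTwoThree

/-! ### §2. (VÉLU₃♯) BY NAME: the ascending constant-kernel `3`-edge as an `Isogeny` object -/

/-- **(VÉLU₃♯) `VeluAscendingEdgeOfCongruenceAtNine` PROVED (an/typer row, `ThreeIsogenyKernelLaws.lean`):** at a datum of
level `9 ∣ N`, a rational point `T = (X₁, Y₁)` of order `3` on `E♮` with `Y₁ ≡ 4(α/3)³ (mod 9)` spans an ASCENDING `3`-edge
`φ : W → W₂` (`W₂` globally minimal, `deg φ = 3`, `covol Λ(W₂) = 3·covol Λ(W)`) with CONSTANT kernel `⟨T⟩` (construction in the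
module docstring). [cite: SilvermanAEC2009, III.4.12 and Thm. VI.4.1(b)] [cite: DokchitserDokchitser2015LocalInvariants, §4 Lemma 10–11] -/
theorem veluAscendingEdgeOfCongruenceAtNine_holds : VeluAscendingEdgeOfCongruenceAtNine := by
  intro W _ _ N _ D h9 X₁ Y₁ hT hcong
  obtain ⟨hA, hB⟩ := norm_shortModel_le_one_of_nine_dvd W D h9
  -- §A the rational `3`-torsion point and the subgroup `⟨T⟩`
  obtain ⟨hns, P₀, hP₀, hfix, hord⟩ := exists_geomPoint_of_isShortThreeTorsion W hT
  set S : AddSubgroup W.geomPoints := AddSubgroup.zmultiples P₀ with hS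
  have hScard : Nat.card S = 3 := by rw [hS, Nat.card_zmultiples, hord]
  have hSfin : (S : Set W.geomPoints).Finite :=
    Nat.finite_of_card_ne_zero (hScard ▸ (by decide : (3 : ℕ) ≠ 0))
  have hSfix : ∀ P ∈ S, ∀ σ : Field.absoluteGaloisGroup ℚ, σ • P = P := by
    intro P hP σ
    obtain ⟨k, rfl⟩ := AddSubgroup.mem_zmultiples_iff.mp hP
    have := map_zsmul (DistribSMul.toAddMonoidHom W.geomPoints σ) k P₀
    simp only [DistribSMul.toAddMonoidHom_apply] at this
    rw [this, hfix]
  have hSstab : ∀ (σ : Field.absoluteGaloisGroup ℚ) (P : W.geomPoints), P ∈ S → σ • P ∈ S :=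
    fun σ P hP ↦ by rw [hSfix P hP σ]; exact hP
  -- §B the quotient isogeny onto a global minimal model
  obtain ⟨W', hW', g, -, hker, -, -⟩ := W.exists_isogeny_ker_eq_and_comp_eq_nsmul_holds S hSfin hSstab
  haveI := hW'
  obtain ⟨uC, hmin⟩ := hasGlobalMinimalModel_rat_holds W'
  haveI : (uC • W').IsGloballyMinimal := hmin
  set W₂ : WeierstrassCurve ℚ := uC • W' with hW₂
  set φ : Isogeny W W₂ := (VariableChange.toIsogeny W' uC).comp g with hφ
  have hkerφ : φ.toAddMonoidHom.ker = S := by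
    rw [hφ, Isogeny.ker_comp, VariableChange.ker_toIsogeny, AddMonoidHom.comap_bot, hker]
  have hdeg : φ.degree = 3 := by
    unfold Isogeny.degree
    rw [hkerφ]; exact hScard
  have hconst : HasConstantKernel φ := by
    intro P hP σ
    rw [hkerφ] at hP
    exact hSfix P hP σ
  have hP₀ker : φ P₀ = 0 := by
    have : P₀ ∈ φ.toAddMonoidHom.ker := by rw [hkerφ, hS]; exact AddSubgroup.mem_zmultiples P₀
    simpa using this
  -- §C uniformisations and the analytic multiplier `α ∈ ℚ`
  haveI : Algebra.IsAlgebraic ℚ (AlgebraicClosure ℚ) := AlgebraicClosure.isAlgebraic ℚ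
  letI : Algebra (AlgebraicClosure ℚ) ℂ := (IsAlgClosed.lift : AlgebraicClosure ℚ →ₐ[ℚ] ℂ).toRingHom.toAlgebra
  haveI : IsScalarTower ℚ (AlgebraicClosure ℚ) ℂ := IsScalarTower.of_algebraMap_eq' (Subsingleton.elim _ _)
  have hL := D.isNeronLattice
  haveI : (W.baseChange ℂ).IsElliptic := by rw [WeierstrassCurve.baseChange]; infer_instance
  haveI : (W₂.baseChange ℂ).IsElliptic := by rw [WeierstrassCurve.baseChange]; infer_instance
  obtain ⟨L₂, hL₂⟩ := exists_isNeronLatticeOf_holds (W₂.baseChange ℂ)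
  obtain ⟨u₂, hker₂, -, hu₂⟩ := L₂.exists_addMonoidHom_of_g₂_g₃' hL₂.1 hL₂.2
  obtain ⟨α, hα0, hαΛ, happ, hcard⟩ := φ.exists_mul_baseChange_apply_eq hL.1 hL.2 hL₂.1 hL₂.2 D.uniformize
    D.ker_uniformize D.uniformize_spec u₂ hker₂ hu₂
  obtain ⟨k, hk⟩ := φ.exists_algebraMap_eq_of_baseChange_apply_eq hL.1 hL.2 hL₂.1 hL₂.2 D.uniformize
    D.ker_uniformize D.uniformize_spec u₂ hker₂ hu₂ happ
  have hkC : (k : ℂ) = α := by rw [← hk, eq_ratCast]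
  -- §D the third-period `z_T` uniformises `±T`, so `α z_T ∈ Λ₂`
  have hsm : shortModel W 1 = (⟨0, 0, 0, -W.c₄ / 48, -W.c₆ / 864⟩ : WeierstrassCurve ℚ) := by
    ext <;> simp [shortModel] <;> ring
  have hq : W.Ψ₃.eval (X₁ - W.b₂ / 12) = 0 := by
    rw [Ψ₃_eval_sub_b₂_div_twelve, ← hsm]
    exact hT.2.eq_zero
  obtain ⟨z₀, hz₀, hx₀, h3z₀⟩ := exists_third_period_of_Ψ₃_root W hL X₁ hq
  have hmemker₂ : ∀ w, u₂ w = 0 ↔ w ∈ L₂.lattice := fun w ↦ by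
    rw [← SetLike.mem_coe, ← hker₂]; rfl
  have hbcm := φ.baseChange_map (M := ℂ) P₀
  have hαz₀ : α * z₀ ∈ L₂.lattice := by
    obtain ⟨hz, huz⟩ := D.uniformize_spec z₀ hz₀
    set ιC := IsScalarTower.toAlgHom ℚ (AlgebraicClosure ℚ) ℂ with hιC
    have hb₂ : (W.baseChange ℂ).b₂ = (W.b₂ : ℂ) := by simp [WeierstrassCurve.baseChange, WeierstrassCurve.map_b₂]
    have hιx : ιC (algebraMap ℚ (AlgebraicClosure ℚ) (X₁ - W.b₂ / 12)) =
        D.L.weierstrassP z₀ - (W.baseChange ℂ).b₂ / 12 := by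
      rw [AlgHom.commutes, hx₀, hb₂, eq_ratCast]; push_cast; ring
    have hnsC := (WeierstrassCurve.Affine.baseChange_nonsingular (W := W) (f := ιC) ιC.toRingHom.injective
      (algebraMap ℚ (AlgebraicClosure ℚ) (X₁ - W.b₂ / 12))
      (algebraMap ℚ (AlgebraicClosure ℚ) (Y₁ - (W.a₁ * (X₁ - W.b₂ / 12) + W.a₃) / 2))).mpr hns
    -- φ_ℂ kills `ι P₀`
    have hkill : φ.baseChange (Affine.Point.map ιC P₀) = 0 := by
      have h := hbcm
      rw [hP₀ker] at h
      refine h.trans ?_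
      exact map_zero _
    -- `ι P₀` as an explicit affine point of `W(ℂ)` (`Affine.Point.map_some` is definitional)
    have hP₀C : Affine.Point.map ιC P₀ = Affine.Point.some _ _ hnsC := by rw [hP₀]; rfl
    have hkey : φ.baseChange (D.uniformize z₀) = 0 := by
      rcases WeierstrassCurve.Affine.Y_eq_of_X_eq hz.left hnsC.left hιx.symm with h | h
      · have e : D.uniformize z₀ = Affine.Point.map ιC P₀ := by
          rw [huz, hP₀C]
          simp only [Affine.Point.some.injEq]
          exact ⟨hιx.symm, h⟩
        rw [e, hkill]
      · have e : D.uniformize z₀ = -Affine.Point.map ιC P₀ := by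
          rw [huz, hP₀C, Affine.Point.neg_some]
          simp only [Affine.Point.some.injEq]
          exact ⟨hιx.symm, h⟩
        rw [e, map_neg, hkill, neg_zero]
    rw [happ z₀] at hkey
    exact (hmemker₂ _).mp hkey
  -- §E Vélu's lattice `Λ_V = Λ + ℤz_T` (p3's construction) and the sandwich `αΛ ⊊ αΛ_V ⊆ Λ₂`, `[Λ₂ : αΛ] = 3`
  set A : ℚ := 1440 * X₁ ^ 2 - 9 * W.c₄ with hAdef
  set B : ℚ := 60480 * X₁ ^ 3 - 756 * W.c₄ * X₁ - 27 * W.c₆ with hBdef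
  have hne : A ^ 3 ≠ B ^ 2 := by
    have hq' := hq
    rw [Ψ₃_eval_sub_b₂_div_twelve] at hq'
    simp only [WeierstrassCurve.Ψ₃, WeierstrassCurve.b₂, WeierstrassCurve.b₄, WeierstrassCurve.b₆, WeierstrassCurve.b₈,
      eval_add, eval_mul, eval_pow, eval_C, eval_X, eval_ofNat] at hq'
    have hψ : 48 * X₁ ^ 4 - 24 * (W.c₄ / 12) * X₁ ^ 2 - 48 * (W.c₆ / 216) * X₁ - (W.c₄ / 12) ^ 2 = 0 := by
      linear_combination 16 * hq'
    have hΔ₀ : (W.c₄ / 12) ^ 3 - 27 * (W.c₆ / 216) ^ 2 ≠ 0 := by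
      have hΔW : W.Δ ≠ 0 := by rw [← WeierstrassCurve.coe_Δ']; exact W.Δ'.ne_zero
      intro h0; apply hΔW
      linear_combination W.c_relation / 1728 + h0
    have h := velu_three_discr_ne_zero hψ hΔ₀
    intro heq; apply h
    rw [hAdef, hBdef] at heq
    linear_combination heq / 1728
  set V : WeierstrassCurve ℚ := ⟨0, 0, 0, -A / 48, -B / 864⟩ with hV
  have hV4 : V.c₄ = A := by
    simp only [hV, WeierstrassCurve.c₄, WeierstrassCurve.b₂, WeierstrassCurve.b₄]; ring
  have hV6 : V.c₆ = B := by
    simp only [hV, WeierstrassCurve.c₆, WeierstrassCurve.b₂, WeierstrassCurve.b₄, WeierstrassCurve.b₆]; ring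
  have hVΔ : V.Δ = (A ^ 3 - B ^ 2) / 1728 := by
    have h := V.c_relation; rw [hV4, hV6] at h; linear_combination h / 1728
  haveI hVell : V.IsElliptic := ⟨isUnit_iff_ne_zero.mpr (by rw [hVΔ]; exact div_ne_zero (sub_ne_zero.mpr hne) (by norm_num))⟩
  haveI : (V.baseChange ℂ).IsElliptic := by rw [WeierstrassCurve.baseChange]; infer_instance
  obtain ⟨LV, hLV⟩ := exists_isNeronLatticeOf_holds (V.baseChange ℂ)
  have hcW : (W.baseChange ℂ).c₄ = (W.c₄ : ℂ) ∧ (W.baseChange ℂ).c₆ = (W.c₆ : ℂ) :=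
    ⟨by simp [WeierstrassCurve.baseChange, WeierstrassCurve.map_c₄], by simp [WeierstrassCurve.baseChange, WeierstrassCurve.map_c₆]⟩
  have hcV : (V.baseChange ℂ).c₄ = (V.c₄ : ℂ) ∧ (V.baseChange ℂ).c₆ = (V.c₆ : ℂ) :=
    ⟨by simp [WeierstrassCurve.baseChange, WeierstrassCurve.map_c₄], by simp [WeierstrassCurve.baseChange, WeierstrassCurve.map_c₆]⟩
  obtain ⟨hc₄W, hc₆W⟩ := hcW
  obtain ⟨hc₄V, hc₆V⟩ := hcV
  have h₂ : LV.g₂ = 120 * D.L.weierstrassP z₀ ^ 2 - 9 * D.L.g₂ := by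
    rw [hLV.1, hc₄V, hV4, hx₀, hL.1, hc₄W, hAdef]; push_cast; ring
  have h₃ : LV.g₃ = 280 * D.L.weierstrassP z₀ ^ 3 - 42 * D.L.g₂ * D.L.weierstrassP z₀ - 27 * D.L.g₃ := by
    rw [hLV.2, hc₆V, hV6, hx₀, hL.1, hL.2, hc₄W, hc₆W, hBdef]; push_cast; ring
  obtain ⟨hleV, hz₀V, hidx⟩ := D.L.lattice_eq_of_velu_three_invariants hz₀ h3z₀ LV h₂ h₃
  -- the three subgroups
  set M₁ : AddSubgroup ℂ := (D.L.mulLeft α hα0).lattice.toAddSubgroup with hM₁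
  set M₂ : AddSubgroup ℂ := (LV.mulLeft α hα0).lattice.toAddSubgroup with hM₂
  set M₃ : AddSubgroup ℂ := L₂.lattice.toAddSubgroup with hM₃
  have h12 : M₁ ≤ M₂ := by
    intro w hw
    rw [hM₁, Submodule.mem_toAddSubgroup, PeriodPair.mem_mulLeft_lattice] at hw
    rw [hM₂, Submodule.mem_toAddSubgroup, PeriodPair.mem_mulLeft_lattice]
    exact hleV hw
  have h23 : M₂ ≤ M₃ := by
    intro w hw
    rw [hM₂, Submodule.mem_toAddSubgroup, PeriodPair.mem_mulLeft_lattice] at hw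
    rw [hM₃, Submodule.mem_toAddSubgroup]
    have ew : w = α * (α⁻¹ * w) := by rw [mul_inv_cancel_left₀ hα0]
    rcases hidx _ hw with h | h | h
    · rw [ew]; exact hαΛ _ h
    · have e : w = α * (α⁻¹ * w - z₀) + α * z₀ := by rw [mul_sub, ← ew]; ring
      rw [e]; exact add_mem (hαΛ _ h) hαz₀
    · have e : w = α * (α⁻¹ * w + z₀) - α * z₀ := by rw [mul_add, ← ew]; ring
      rw [e]; exact sub_mem (hαΛ _ h) hαz₀
  have h13 : M₁.relIndex M₃ = 3 := by
    rw [hM₁, hM₃, ← hcard, Isogeny.natCard_ker_baseChange_eq_degree, hdeg]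
  have hαz₀M₁ : α * z₀ ∉ M₁ := by
    rw [hM₁, Submodule.mem_toAddSubgroup, PeriodPair.mem_mulLeft_lattice, inv_mul_cancel_left₀ hα0]
    exact hz₀
  have hαz₀M₂ : α * z₀ ∈ M₂ := by
    rw [hM₂, Submodule.mem_toAddSubgroup, PeriodPair.mem_mulLeft_lattice, inv_mul_cancel_left₀ hα0]
    exact hz₀V
  have hM₂₃ : M₂ = M₃ := by
    have hmul := AddSubgroup.relIndex_mul_relIndex M₁ M₂ M₃ h12 h23
    rw [h13] at hmul
    have hne1 : M₁.relIndex M₂ ≠ 1 := by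
      rw [Ne, AddSubgroup.relIndex_eq_one]
      exact fun hle ↦ hαz₀M₁ (hle hαz₀M₂)
    have hdvd : M₂.relIndex M₃ ∣ 3 := Dvd.intro_left _ hmul
    rcases (Nat.dvd_prime Nat.prime_three).mp hdvd with h1 | h3
    · exact le_antisymm h23 (AddSubgroup.relIndex_eq_one.mp h1)
    · rw [h3] at hmul
      exact absurd (by omega : M₁.relIndex M₂ = 1) hne1
  have hΛ₂ : L₂.lattice = (LV.mulLeft α hα0).lattice := by
    apply le_antisymm
    · intro w hw
      have : w ∈ M₃ := by rw [hM₃, Submodule.mem_toAddSubgroup]; exact hw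
      rw [← hM₂₃, hM₂, Submodule.mem_toAddSubgroup] at this
      exact this
    · intro w hw
      have : w ∈ M₂ := by rw [hM₂, Submodule.mem_toAddSubgroup]; exact hw
      rw [hM₂₃, hM₃, Submodule.mem_toAddSubgroup] at this
      exact this
  -- §F invariants of `W₂`: `α⁴ c₄(W₂) = A`, `α⁶ c₆(W₂) = B`, with `α = k ∈ ℚ`
  obtain ⟨e₄, e₆⟩ := IsNeronLatticeOf.c₄_eq_of_lattice_eq_mulLeft hL₂ hα0 hΛ₂
  rw [hLV.1, hc₄V, hV4] at e₄
  rw [hLV.2, hc₆V, hV6] at e₆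
  have h4 : (k : ℚ) ^ 4 * W₂.c₄ = A := by
    have : ((k : ℚ) : ℂ) ^ 4 * (W₂.c₄ : ℂ) = (A : ℂ) := by
      rw [e₄, hkC]; field_simp
    exact_mod_cast this
  have h6 : (k : ℚ) ^ 6 * W₂.c₆ = B := by
    have : ((k : ℚ) : ℂ) ^ 6 * (W₂.c₆ : ℂ) = (B : ℂ) := by
      rw [e₆, hkC]; field_simp
    exact_mod_cast this
  -- §G `k ∈ ℤ`, `k ∣ 3`, and `k ≠ ±1` by the local theorem: `k = ±3`
  have h3mul : ∀ w : ℂ, w ∈ D.L.lattice → 3 * w ∈ D.L.lattice := fun w hw ↦ by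
    have e : (3 : ℂ) * w = w + w + w := by ring
    rw [e]; exact add_mem (add_mem hw hw) hw
  have h3v : ∀ v : ℂ, v ∈ LV.lattice → 3 * v ∈ D.L.lattice := fun v hv ↦ by
    rcases hidx v hv with h | h | h
    · exact h3mul v h
    · have e : (3 : ℂ) * v = 3 * (v - z₀) + 3 * z₀ := by ring
      rw [e]; exact add_mem (h3mul _ h) h3z₀
    · have e : (3 : ℂ) * v = 3 * (v + z₀) - 3 * z₀ := by ring
      rw [e]; exact sub_mem (h3mul _ h) h3z₀
  have hμ : ∀ y ∈ D.L.lattice, ((k : ℚ) : ℂ) * y ∈ L₂.lattice := fun y hy ↦ by rw [hkC]; exact hαΛ y hy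
  have hnμ : ∀ z ∈ L₂.lattice, ∃ y ∈ D.L.lattice, ((3 : ℤ) : ℂ) * z = ((k : ℚ) : ℂ) * y := fun z hz ↦ by
    rw [hΛ₂, PeriodPair.mem_mulLeft_lattice] at hz
    refine ⟨3 * (α⁻¹ * z), h3v _ hz, ?_⟩
    rw [hkC]; field_simp; push_cast; ring
  obtain ⟨m, hm, hm3⟩ := exists_int_eq_and_dvd_of_neronScaling W W₂ D.L L₂ hL hL₂ k (n := 3) three_ne_zero hμ hnμ
  have hno := not_exists_isGloballyMinimal_velu_three_of_congruence W hA hB hT hcong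
  have hk9 : (k : ℚ) ^ 2 = 9 := by
    rcases int_dvd_three_cases hm3 with rfl | rfl | rfl | rfl
    · exfalso; refine hno ⟨W₂, inferInstance, hmin, ?_, ?_⟩
      · rw [← hAdef, ← h4, ← hm]; push_cast; ring
      · rw [← hBdef, ← h6, ← hm]; push_cast; ring
    · exfalso; refine hno ⟨W₂, inferInstance, hmin, ?_, ?_⟩
      · rw [← hAdef, ← h4, ← hm]; push_cast; ring
      · rw [← hBdef, ← h6, ← hm]; push_cast; ring
    · rw [← hm]; norm_num
    · rw [← hm]; norm_num
  have hαnorm : ‖α‖ ^ 2 = 9 := by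
    rw [← hkC]
    have : ‖((k : ℚ) : ℂ)‖ ^ 2 = ‖(((k : ℚ) ^ 2 : ℚ) : ℂ)‖ := by push_cast; rw [norm_pow]
    rw [this, hk9]; norm_num
  -- §H covolumes: `covol(αΛ) = 3 covol Λ₂`, `covol(αΛ) = 9 covol Λ`
  have hcovM : ZLattice.covolume (D.L.mulLeft α hα0).lattice / ZLattice.covolume L₂.lattice = 3 := by
    have h := ZLattice.covolume_div_covolume_eq_relIndex' (D.L.mulLeft α hα0).lattice L₂.lattice
      (fun w hw ↦ by
        have : w ∈ M₁ := by rw [hM₁, Submodule.mem_toAddSubgroup]; exact hw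
        have := h23 (h12 this)
        rw [hM₃, Submodule.mem_toAddSubgroup] at this
        exact this)
    rw [h]
    exact_mod_cast h13
  have hcov : ZLattice.covolume L₂.lattice = 3 * ZLattice.covolume D.L.lattice := by
    rw [D.L.covolume_mulLeft_lattice α hα0, hαnorm] at hcovM
    have hpos : 0 < ZLattice.covolume L₂.lattice := ZLattice.covolume_pos L₂.lattice MeasureTheory.volume
    rw [div_eq_iff hpos.ne'] at hcovM
    linarith
  exact ⟨W₂, inferInstance, hmin, φ, L₂, ⟨hdeg, hL, hL₂, hcov⟩, hconst⟩

/-! ### §3. By-name consequences: NB₃ and NB₃^V follow from an's E-an-100₉ / E-an-100 / E-an-99 -/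

/-- **NB₃ ⟸ E-an-100₉ (BY NAME).**  The registered C3 stub NB₃ `NoBlindThreeTorsionOptimal` follows from an's law
`NoConstantKernelAscendingThreeOptimalAtNine` alone: (VÉLU₃♯) is now a theorem, and blind ⟹ congruent (p643768).
[cite: SilvermanAEC2009, III.4.12 and Thm. VI.4.1(b)] -/
theorem noBlindThreeTorsionOptimal_of_noConstantKernelAscendingAtNine (h100 : NoConstantKernelAscendingThreeOptimalAtNine) :
    NoBlindThreeTorsionOptimal := by
  intro W _ _ N _ D hL h9 X₁ Y₁ hT hb
  exact no_congruent_threeTorsion_of_laws h100 veluAscendingEdgeOfCongruenceAtNine_holds W D hL h9 X₁ Y₁ hT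
    (threeBlind_congruence_mod_nine_of_nine_dvd W D h9 hT hb)

/-- **NB₃^V ⟸ E-an-100₉ (BY NAME).**  The v14 stub `NoAscendingThreeTorsionOptimal` follows from an's law
`NoConstantKernelAscendingThreeOptimalAtNine` (ascent ⟹ congruence, p646773, then (VÉLU₃♯) gives the forbidden edge).
[cite: SilvermanAEC2009, III.4.12 and Thm. VI.4.1(b)] -/
theorem noAscendingThreeTorsionOptimal_of_noConstantKernelAscendingAtNine
    (h100 : NoConstantKernelAscendingThreeOptimalAtNine) : NoAscendingThreeTorsionOptimal := by
  intro W _ _ N _ D hL h9 X₁ Y₁ hT hex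
  exact no_congruent_threeTorsion_of_laws h100 veluAscendingEdgeOfCongruenceAtNine_holds W D hL h9 X₁ Y₁ hT
    ((exists_isGloballyMinimal_three_velu_three_iff_congruence_of_nine_dvd W D h9 hT).mp hex)

/-- **NB₃^V ⟸ E-an-100** (all levels) and hence **⟸ E-an-99 ASCμ₃** («an `X₀(N)`-optimal curve ascends at `3` only through
`μ₃`»), by an's proved edges `noConstantKernelAscendingAtNine_of_all` / `noConstantKernelAscending_of_kernelIsMu`.
[cite: Vatsal2005, Conj 1.9 (shape only: the laws are the cell's E-an-99/100, implied by Stevens' Conjecture II)] -/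
theorem noAscendingThreeTorsionOptimal_of_optimalAscendingThreeKernelIsMu (h99 : OptimalAscendingThreeKernelIsMu) :
    NoAscendingThreeTorsionOptimal :=
  noAscendingThreeTorsionOptimal_of_noConstantKernelAscendingAtNine
    (noConstantKernelAscendingAtNine_of_all (noConstantKernelAscending_of_kernelIsMu h99))

/-! ### §4. The C3 line `kato_shift_three` v14 BY NAME, as tree theorems -/

/-- **C3 ⟸ F-es-18 ∧ E-an-57 ∧ LAW₃♮ ∧ NB₃^V ∧ RES₃♭** (the v14 composition of line `kato_shift_three` as ONE tree theorem:
the lead's v10 composition with NB₃ fed by NB₃^V through p645684).  CONDITIONAL reduction; nothing about BSD is proved.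
[cite: Kato2004Asterisque, Thm. 6.6 (1) (shape of the input F-es-18 only)] -/
theorem maninPrimeToThreeAtNine_of_katoFact_of_cuspidalKummerCube_of_nonBlindLaw_of_noAscending_of_coprimeIsolated
    (h₁ : kato_neron_isIntegral_twistedSymbolSum_of_additive_three_polar) (h₂ : CuspidalKummerCubeRepresentativeAtNine)
    (h₄ : CuspidalKummerCubeExponentLawNonBlind) (hV : NoAscendingThreeTorsionOptimal)
    (h₅ : NoRationalThreeTorsionCoprimeIsolatedResidual) :
    Summit.BirchSwinnertonDyer.BirchSwinnertonDyer.Theses.ManinLocalTwoThree.ManinPrimeToThreeAtNine :=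
  maninPrimeToThreeAtNine_of_katoFact_of_cuspidalKummerCube_of_noBlindLaws_of_coprimeIsolated h₁ h₂ h₄
    (noBlindThreeTorsionOptimal_of_noAscendingThreeTorsionOptimal hV) h₅

/-- **C3 ⟸ F-es-18 ∧ E-an-57 ∧ LAW₃♮ ∧ E-an-100₉ ∧ RES₃♭** (an's Stevens-ledger row in place of NB₃^V; BY NAME through §2/§3).
CONDITIONAL reduction; nothing about BSD is proved. [cite: Kato2004Asterisque, Thm. 6.6 (1) (shape of the input F-es-18 only)] -/
theorem maninPrimeToThreeAtNine_of_katoFact_of_cuspidalKummerCube_of_nonBlindLaw_of_noConstantKernelAscending_of_coprimeIsolated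
    (h₁ : kato_neron_isIntegral_twistedSymbolSum_of_additive_three_polar) (h₂ : CuspidalKummerCubeRepresentativeAtNine)
    (h₄ : CuspidalKummerCubeExponentLawNonBlind) (h100 : NoConstantKernelAscendingThreeOptimalAtNine)
    (h₅ : NoRationalThreeTorsionCoprimeIsolatedResidual) :
    Summit.BirchSwinnertonDyer.BirchSwinnertonDyer.Theses.ManinLocalTwoThree.ManinPrimeToThreeAtNine :=
  maninPrimeToThreeAtNine_of_katoFact_of_cuspidalKummerCube_of_noBlindLaws_of_coprimeIsolated h₁ h₂ h₄
    (noBlindThreeTorsionOptimal_of_noConstantKernelAscendingAtNine h100) h₅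

/-- **C3 ⟸ F-es-18 ∧ E-an-57 ∧ LAW₃♮ ∧ E-an-99 (ASCμ₃) ∧ RES₃♭** (BY NAME through an's E-an-99 ⟹ E-an-100 ⟹ E-an-100₉ and §3).
CONDITIONAL reduction; nothing about BSD is proved. [cite: Kato2004Asterisque, Thm. 6.6 (1) (shape of the input F-es-18 only)] -/
theorem maninPrimeToThreeAtNine_of_katoFact_of_cuspidalKummerCube_of_nonBlindLaw_of_kernelIsMu_of_coprimeIsolated
    (h₁ : kato_neron_isIntegral_twistedSymbolSum_of_additive_three_polar) (h₂ : CuspidalKummerCubeRepresentativeAtNine)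
    (h₄ : CuspidalKummerCubeExponentLawNonBlind) (h99 : OptimalAscendingThreeKernelIsMu)
    (h₅ : NoRationalThreeTorsionCoprimeIsolatedResidual) :
    Summit.BirchSwinnertonDyer.BirchSwinnertonDyer.Theses.ManinLocalTwoThree.ManinPrimeToThreeAtNine :=
  maninPrimeToThreeAtNine_of_katoFact_of_cuspidalKummerCube_of_noBlindLaws_of_coprimeIsolated h₁ h₂ h₄
    (noBlindThreeTorsionOptimal_of_noAscendingThreeTorsionOptimal
      (noAscendingThreeTorsionOptimal_of_optimalAscendingThreeKernelIsMu h99)) h₅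

end Summit.BirchSwinnertonDyer.BirchSwinnertonDyer.Theorems.ManinLocalTwoThree

end
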